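import Summits.CriticalPhenomena.PercolationContinuityZ3.Theorems.PercNearOneGluingNoHeavyRsw3SetToSetTwoPointOneArmUpper
import Summits.CriticalPhenomena.PercolationContinuityZ3.Theorems.PercNearOneGluingNoHeavyRsw3TwoPointHarrisMoves
import HarnessLib

/-!
# RSW3 lane (P2, gen 17): (A2)□ at `p_c(ℤ^d)` ⇒ `τ_{p_c}(0, x) ≍ π_{p_c}(‖x‖_∞)²` for every `x` in the `½`-CONE around an axis
# (`2|x_j| ≤ |x_i|` for `j ≠ i`): the two-point/one-arm identity off the axis, for a positive fraction of every sphere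

builds on p205010 (kernel theorem, internal audit signed; external expert review pending) — NOT used in this file.

Cell `prim-rsw3`, prover seat `prim-rsw3-p2` (gen 17), memo `run/shared/lean/prim/rsw3/P2-RSWLITE.md` §24.
Support file (`--supports stmt-CriticalPhenomena-4575`); no definitions, no named facts, no sorries.

The axis file (`…TwoPointOneArm.lean`) proves `c·π(n)² ≤ τ(0, n e₁)` under (A2)□; here the same inward-continuation argument is run
for every `x` whose largest coordinate `x_i` dominates the others by a factor `2` (the `½`-cone around the axis `i`, in either
direction).  The only change is the target of the last arm: from `x' = x` with `x_i` moved to `±(Lm+1)` (Harris along the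
coordinate, `pow_mul_tau_le_tau_update`), the arm to `∂ⁱⁿΛ((L-1)m)` is produced inside `Λ_{x'}(m+1)` by the face `{z_i = ±(L-1)m}`
of that ball, which lies ON the sphere because the other coordinates satisfy `|x_j| + m + 1 ≤ (L-1)m` (cone + `L ≥ 8`, obtained for
free from `SetToSetQuasiMultAspectAt.mono_outer`); centre-to-face `≥ π(m+1)/(2d)` by the hyperoctahedral symmetry
(`oneArmProb_div_le_real_openCrossing_face_cone`).  Small `‖x‖` is covered by `p^{‖x‖₁} ≤ τ(0,x)` (`pow_norm1_le_tau`).  Together with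
the every-`p` upper bound `tau_le_sq_oneArmProb_of_lt` and one-arm doubling, `τ(0,x) ≍ π(‖x‖_∞)²` on the cones
(`exists_tau_cone_two_sided_of_setToSetQuasiMultAspectAt`).  The cones carry a positive fraction `≥ (2d)⁻¹·2^{-(d-1)}`-ish of every
sphere, which is what summed (susceptibility-type) hyperscaling statements need; points near the diagonals would require aiming an
arm at a prescribed ball (not done here).

References: H. Kesten, Comm. Math. Phys. 109 (1987) (planar `τ ≍ π²`) [Kesten1987]; D. Basu, A. Sapozhnikov, ECP 22 (2017) no. 26,
§1 (A2) [BasuSapozhnikov2017ECP]; G. Grimmett, *Percolation* (1999), Thm. 2.4, proof of Thm. (6.10) [GrimmettPercolation1999]. [folklore]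
-/

noncomputable section

namespace Summit.CriticalPhenomena.PercolationContinuityZ3.Theorems

namespace Rsw3

open MeasureTheory Literature.Probability.LatticeModels Literature.Probability.Percolation
open SurfaceTension Crossing SimpleGraph

variable {d : ℕ}

/-! ## The theorem on the cone -/

/-- **(A2)□ at `p_c(ℤ^d)` ⇒ `c · π_{p_c}(|x_i|)² ≤ τ_{p_c}(0, x)` on the `½`-cone around the axis `i`** (`d ≥ 2`, `2 ≤ s < L`, `ϰ > 0`):
under `SetToSetQuasiMultAspectAt d p_c s L ϰ` there is `c > 0` such that for every `x` and `i` with `|x_i| ≥ 1` and `2|x_j| ≤ |x_i|`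
for all `j ≠ i`: `c · oneArmProb d p_c |x_i| ^ 2 ≤ tau d p_c 0 x`.  (The axis is the case `x_j = 0`.)
[cite: BasuSapozhnikov2017ECP, §1 assumption (A2)] [cite: Kesten1987, §1 (scaling relations)] -/
theorem exists_mul_sq_oneArmProb_le_tau_cone_of_setToSetQuasiMultAspectAt (hd : 2 ≤ d) {s L : ℕ} {ϰ : ℝ}
    (h : SetToSetQuasiMultAspectAt d (criticalProbI d) s L ϰ) (hϰ : 0 < ϰ) (hs : 2 ≤ s) (hsL : s < L) :
    ∃ c : ℝ, 0 < c ∧ ∀ (x : Site d) (i : Fin d), 1 ≤ (x i).natAbs → (∀ j, j ≠ i → 2 * (x j).natAbs ≤ (x i).natAbs) →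
      c * oneArmProb d (criticalProbI d) (x i).natAbs ^ 2 ≤ tau d (criticalProbI d) 0 x := by
  classical
  have hd1 : 1 ≤ d := by omega
  set pc : unitInterval := criticalProbI d with hpcdef
  have hpc : 0 < (pc : ℝ) := by rw [hpcdef, coe_criticalProbI]; exact criticalProb_zd_pos d hd1
  have hpc1 : (pc : ℝ) ≤ 1 := pc.2.2
  -- WLOG `ϰ ≤ 1` and `L ≥ 8` (larger `L` is weaker)
  obtain ⟨L', hL'⟩ : ∃ L' : ℕ, L' = max L 8 := ⟨_, rfl⟩
  have hLL' : L ≤ L' := by rw [hL']; exact le_max_left _ _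
  have hL'8 : 8 ≤ L' := by rw [hL']; exact le_max_right _ _
  have hsL' : s < L' := lt_of_lt_of_le hsL hLL'
  set ϰ₁ : ℝ := min ϰ 1 with hϰ₁
  have h₁ : SetToSetQuasiMultAspectAt d pc s L' ϰ₁ := (setToSetQuasiMultAspectAt_of_le (min_le_left ϰ 1) h).mono_outer hLL'
  have hϰ₁0 : 0 < ϰ₁ := lt_min hϰ one_pos
  have hϰ₁1 : ϰ₁ ≤ 1 := min_le_right ϰ 1
  have hu₀ : 0 < (2 * (d : ℝ))⁻¹ * ((4 * (s : ℝ)) ^ (d - 1))⁻¹ := by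
    have : (0 : ℝ) < d := by exact_mod_cast (show 0 < d by omega)
    have : (0 : ℝ) < s := by exact_mod_cast (show 0 < s by omega)
    positivity
  obtain ⟨κ, hκ, hcont⟩ := exists_inward_continuation_const h₁ hϰ₁0 hϰ₁1 hs hsL' (show s ≤ L' - 1 by omega)
    (show L' - 1 < L' by omega) le_rfl hpc hu₀ (fun n hn => le_real_boxCrossing_mul_criticalProbI hd (by omega) hn)
  have hdpos : (0 : ℝ) < d := by exact_mod_cast (show 0 < d by omega)
  have hd0 : (0 : ℝ) < 2 * d := by linarith
  -- the constant: small `x` (`|x_i| < 4 L'`) by `p^{‖x‖₁} ≥ p^{4 d L'}`, large by the chain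
  obtain ⟨N₀, hN₀⟩ : ∃ N₀ : ℕ, N₀ = 4 * L' * d := ⟨_, rfl⟩
  set c : ℝ := min ((pc : ℝ) ^ N₀) ((pc : ℝ) ^ L' * (ϰ₁ * κ / (2 * d))) with hc
  have hcpos : 0 < c := lt_min (pow_pos hpc _) (by positivity)
  refine ⟨c, hcpos, fun x i hxi hcone => ?_⟩
  obtain ⟨n, hn⟩ : ∃ n : ℕ, n = (x i).natAbs := ⟨_, rfl⟩
  rw [← hn] at hxi hcone ⊢
  have hπ1 : oneArmProb d pc n ≤ 1 := measureReal_le_one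
  have hπ0 : 0 ≤ oneArmProb d pc n := measureReal_nonneg
  have hxk : ∀ k, (x k).natAbs ≤ n := by
    intro k; by_cases hk : k = i
    · subst hk; rw [hn]
    · have := hcone k hk; omega
  by_cases hsmall : n < 4 * L'
  · -- small: `‖x‖₁ ≤ d n ≤ N₀`
    have hsum : ∑ k, (x k).natAbs ≤ N₀ := by
      calc ∑ k, (x k).natAbs ≤ ∑ _k : Fin d, n := Finset.sum_le_sum fun k _ => hxk k
        _ = d * n := by simp
        _ ≤ N₀ := by rw [hN₀]; nlinarith
    calc c * oneArmProb d pc n ^ 2 ≤ (pc : ℝ) ^ N₀ * 1 :=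
          mul_le_mul (min_le_left _ _) (by nlinarith) (sq_nonneg _) (pow_nonneg hpc.le _)
      _ ≤ (pc : ℝ) ^ (∑ k, (x k).natAbs) := by rw [mul_one]; exact pow_le_pow_of_le_one hpc.le hpc1 hsum
      _ ≤ tau d pc 0 x := pow_norm1_le_tau pc x
  · -- large: `n = L' m + 1 + j`, `m ≥ 3`, `j < L'`
    push Not at hsmall
    obtain ⟨m, hm⟩ : ∃ m : ℕ, m = (n - 1) / L' := ⟨_, rfl⟩
    have hL0 : 0 < L' := by omega
    obtain ⟨P, hP⟩ : ∃ P : ℕ, P = L' * m := ⟨_, rfl⟩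
    have hdm := Nat.div_add_mod (n - 1) L'
    have hml := Nat.mod_lt (n - 1) hL0
    rw [← hm, ← hP] at hdm
    have hm3 : 3 ≤ m := by rw [hm]; exact (Nat.le_div_iff_mul_le hL0).2 (by omega)
    obtain ⟨j, hj⟩ : ∃ j : ℕ, j = n - 1 - P := ⟨_, rfl⟩
    have hjL : j < L' := by omega
    have hnj : n = P + 1 + j := by omega
    obtain ⟨Sm, hSm⟩ : ∃ Q : ℕ, Q = s * m := ⟨_, rfl⟩
    obtain ⟨L1m, hL1m⟩ : ∃ Q : ℕ, Q = (L' - 1) * m := ⟨_, rfl⟩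
    have hL1P : L1m + m = P := by
      rw [hL1m, hP, tsub_mul, one_mul]; exact Nat.sub_add_cancel (Nat.le_mul_of_pos_left m hL0)
    have hSmP : Sm ≤ P := by rw [hSm, hP]; exact Nat.mul_le_mul_right m hsL'.le
    have h8m : 8 * m ≤ P := by rw [hP]; exact Nat.mul_le_mul_right m hL'8
    have h3L : L' * 3 ≤ P := by rw [hP]; exact Nat.mul_le_mul_left L' hm3
    -- the moved point `x' = x[i ↦ σ (P+1)]`
    obtain ⟨σ, hσ, hσx⟩ : ∃ σ : ℤ, (σ = 1 ∨ σ = -1) ∧ σ * (x i) = n := by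
      rcases le_or_gt 0 (x i) with h0 | h0
      · exact ⟨1, Or.inl rfl, by rw [hn]; omega⟩
      · exact ⟨-1, Or.inr rfl, by rw [hn]; omega⟩
    set y : Site d := Function.update x i (σ * (((P + 1 : ℕ) : ℤ))) with hy
    have hyi : y i = σ * (((P + 1 : ℕ) : ℤ)) := by rw [hy, Function.update_self]
    have hyj : ∀ k, k ≠ i → y k = x k := fun k hk => by rw [hy, Function.update_of_ne hk]
    -- Harris: `τ(0,x) ≥ p^j τ(0,y)` (move coordinate `i` from `σ(P+1)` to `x_i = σ n`)
    have hharris : (pc : ℝ) ^ j * tau d pc 0 y ≤ tau d pc 0 x := by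
      have h := pow_mul_tau_le_tau_update pc y i (x i)
      have hupd : Function.update y i (x i) = x := by
        rw [hy, Function.update_idem, Function.update_eq_self]
      rw [hupd, hyi] at h
      have hdist : (x i - σ * (((P + 1 : ℕ) : ℤ))).natAbs = j := by
        rcases hσ with h1 | h1 <;> rw [h1] at hσx ⊢ <;> push_cast <;> omega
      rwa [hdist] at h
    -- the big box `Z` and (A2)□ at `(m, Z, {0}, {y})`
    set Z : Finset (Site d) := box d (n + m + 2) with hZ
    have hZ' : box d (L' * m) \ box d (m - 1) ⊆ Z := fun z hz =>
      box_mono d (by rw [← hP]; omega) (Finset.mem_sdiff.1 hz).1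
    have hX' : ({(0 : Site d)} : Finset (Site d)) ⊆ Z ∩ box d m := by
      rw [Finset.singleton_subset_iff, Finset.mem_inter]; exact ⟨zero_mem_box d _, zero_mem_box d _⟩
    have hyZ : y ∈ Z := by
      rw [hZ, mem_box_iff_natAbs]
      intro k; by_cases hk : k = i
      · subst hk; rw [hyi]; rcases hσ with h1 | h1 <;> rw [h1] <;> push_cast <;> omega
      · rw [hyj k hk]; have := hxk k; omega
    have hyL : y ∉ box d (L' * m) := by
      intro h'
      have := (mem_box_iff_natAbs.1 h') i
      rw [hyi, ← hP] at this
      rcases hσ with h1 | h1 <;> rw [h1] at this <;> push_cast at this <;> omega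
    have hY' : ({y} : Finset (Site d)) ⊆ Z \ box d (L' * m) := by
      rw [Finset.singleton_subset_iff, Finset.mem_sdiff]; exact ⟨hyZ, hyL⟩
    have hA2 := h₁ m (by omega) Z hZ' {0} hX' {y} hY'
    change ϰ₁ * ((bondPercolation (zdGraph d) pc).real (openCrossing (↑Z : Set (Site d)) ↑({(0 : Site d)} : Finset (Site d))
        ↑(innerBoundary (zdGraph d) (box d (s * m)))) *
        (bondPercolation (zdGraph d) pc).real (openCrossing (↑Z : Set (Site d)) ↑({y} : Finset (Site d))
        ↑(innerBoundary (zdGraph d) (box d (s * m))))) ≤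
        (bondPercolation (zdGraph d) pc).real (openCrossing (↑Z : Set (Site d)) ↑({(0 : Site d)} : Finset (Site d))
          ↑({y} : Finset (Site d))) at hA2
    -- first factor ≥ π(n)
    have hF1 : oneArmProb d pc n ≤ (bondPercolation (zdGraph d) pc).real
        (openCrossing (↑Z : Set (Site d)) ↑({(0 : Site d)} : Finset (Site d)) ↑(innerBoundary (zdGraph d) (box d (s * m)))) :=
      oneArmProb_le_real_openCrossing_zero pc (by rw [← hSm]; omega) (box_mono d (by rw [← hSm]; omega))
    -- second factor ≥ κ · π(n)/(2d): inward continuation to `S_{(L'-1)m}`, then the face of `Λ_y(m+1)`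
    have hcont' := hcont m (by omega) Z {y} hZ' hY'
    have hface : oneArmProb d pc (m + 1) / (2 * d) ≤ (bondPercolation (zdGraph d) pc).real
        (openCrossing (↑Z : Set (Site d)) ↑({y} : Finset (Site d)) ↑(innerBoundary (zdGraph d) (box d ((L' - 1) * m)))) := by
      -- the sign unit `ε = -σ`
      obtain ⟨ε, hε⟩ : ∃ ε : ℤˣ, (ε : ℤ) = -σ := by
        rcases hσ with h1 | h1
        · exact ⟨-1, by rw [h1]; rfl⟩
        · exact ⟨1, by rw [h1]; rfl⟩
      have hyi' : y i = -(ε : ℤ) * ((((L' - 1) * m + (m + 1) : ℕ) : ℤ)) := by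
        rw [hyi, hε, neg_neg, ← hL1m]
        congr 1; push_cast; omega
      have hyj' : ∀ k, k ≠ i → (y k).natAbs + (m + 1) ≤ (L' - 1) * m := by
        intro k hk
        rw [hyj k hk, ← hL1m]
        have := hcone k hk
        omega
      have hball : GM.ball y (m + 1) ⊆ Z := by
        intro z hz
        rw [GM.mem_ball] at hz
        rw [hZ, mem_box]
        intro k
        have h1 := hz k
        by_cases hk : k = i
        · subst hk; rw [hyi] at h1; rcases hσ with h2 | h2 <;> rw [h2] at h1 <;> push_cast at h1 ⊢ <;> omega
        · rw [hyj k hk] at h1; have := hxk k; push_cast at h1 ⊢; omega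
      exact oneArmProb_div_le_real_openCrossing_face_cone hd1 pc (r := m + 1) (R := (L' - 1) * m) (by rw [← hL1m]; omega)
        i ε y hyi' hyj' hball
    have hF2 : κ * (oneArmProb d pc n / (2 * d)) ≤ (bondPercolation (zdGraph d) pc).real
        (openCrossing (↑Z : Set (Site d)) ↑({y} : Finset (Site d)) ↑(innerBoundary (zdGraph d) (box d (s * m)))) := by
      have hmono : oneArmProb d pc n ≤ oneArmProb d pc (m + 1) := DCT16.real_siteToBoundary_antitone pc (by omega)
      calc κ * (oneArmProb d pc n / (2 * d)) ≤ κ * (oneArmProb d pc (m + 1) / (2 * d)) :=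
            mul_le_mul_of_nonneg_left (div_le_div_of_nonneg_right hmono hd0.le) hκ.le
        _ ≤ κ * (bondPercolation (zdGraph d) pc).real (openCrossing (↑Z : Set (Site d)) ↑({y} : Finset (Site d))
              ↑(innerBoundary (zdGraph d) (box d ((L' - 1) * m)))) := mul_le_mul_of_nonneg_left hface hκ.le
        _ ≤ _ := hcont'
    -- the conclusion ≤ τ(0, y)
    have hconc : (bondPercolation (zdGraph d) pc).real (openCrossing (↑Z : Set (Site d)) ↑({(0 : Site d)} : Finset (Site d))
          ↑({y} : Finset (Site d))) ≤ tau d pc 0 y := by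
      rw [tau_def]
      refine measureReal_mono (fun ω hω => ?_) (measure_ne_top _ _)
      obtain ⟨x₀, hx₀, y', hy', hxy⟩ := hω
      rw [Finset.coe_singleton, Set.mem_singleton_iff] at hx₀ hy'
      subst hx₀; subst hy'
      exact openConnIn_subset_openConn _ _ _ hxy
    have hκd : 0 ≤ κ * (oneArmProb d pc n / (2 * d)) := mul_nonneg hκ.le (div_nonneg hπ0 hd0.le)
    have hπ2 : ϰ₁ * κ / (2 * d) * oneArmProb d pc n ^ 2 ≤ tau d pc 0 y := by
      calc ϰ₁ * κ / (2 * d) * oneArmProb d pc n ^ 2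
          = ϰ₁ * (oneArmProb d pc n * (κ * (oneArmProb d pc n / (2 * d)))) := by ring
        _ ≤ ϰ₁ * ((bondPercolation (zdGraph d) pc).real (openCrossing (↑Z : Set (Site d))
              ↑({(0 : Site d)} : Finset (Site d)) ↑(innerBoundary (zdGraph d) (box d (s * m)))) *
            (bondPercolation (zdGraph d) pc).real (openCrossing (↑Z : Set (Site d)) ↑({y} : Finset (Site d))
              ↑(innerBoundary (zdGraph d) (box d (s * m))))) :=
            mul_le_mul_of_nonneg_left (mul_le_mul hF1 hF2 hκd measureReal_nonneg) hϰ₁0.le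
        _ ≤ _ := hA2.trans hconc
    have hrest : 0 ≤ ϰ₁ * κ / (2 * d) * oneArmProb d pc n ^ 2 := by
      have : 0 ≤ ϰ₁ * κ / (2 * d) := div_nonneg (mul_nonneg hϰ₁0.le hκ.le) hd0.le
      exact mul_nonneg this (sq_nonneg _)
    calc c * oneArmProb d pc n ^ 2 ≤ (pc : ℝ) ^ L' * (ϰ₁ * κ / (2 * d)) * oneArmProb d pc n ^ 2 :=
          mul_le_mul_of_nonneg_right (min_le_right _ _) (sq_nonneg _)
      _ = (pc : ℝ) ^ L' * (ϰ₁ * κ / (2 * d) * oneArmProb d pc n ^ 2) := by ring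
      _ ≤ (pc : ℝ) ^ j * (ϰ₁ * κ / (2 * d) * oneArmProb d pc n ^ 2) :=
          mul_le_mul_of_nonneg_right (pow_le_pow_of_le_one hpc.le hpc1 hjL.le) hrest
      _ ≤ (pc : ℝ) ^ j * tau d pc 0 y := mul_le_mul_of_nonneg_left hπ2 (pow_nonneg hpc.le j)
      _ ≤ tau d pc 0 x := hharris

/-- **(A2)□ ⇒ `τ ≍ π²` on the cones** (`p_c(ℤ^d)`, `d ≥ 2`, `2 ≤ s < L`, `ϰ > 0`): `0 < c ≤ C` with
`c · π(|x_i|)² ≤ τ(0, x) ≤ C · π(|x_i|)²` for every `x`, `i` with `|x_i| ≥ 1` and `2|x_j| ≤ |x_i|` (`j ≠ i`).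
[cite: Kesten1987, §1 (scaling relations)] [cite: BasuSapozhnikov2017ECP, §1 assumption (A2)] -/
theorem exists_tau_cone_two_sided_of_setToSetQuasiMultAspectAt (hd : 2 ≤ d) {s L : ℕ} {ϰ : ℝ}
    (h : SetToSetQuasiMultAspectAt d (criticalProbI d) s L ϰ) (hϰ : 0 < ϰ) (hs : 2 ≤ s) (hsL : s < L) :
    ∃ c C : ℝ, 0 < c ∧ 0 < C ∧ ∀ (x : Site d) (i : Fin d), 1 ≤ (x i).natAbs →
      (∀ j, j ≠ i → 2 * (x j).natAbs ≤ (x i).natAbs) →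
        c * oneArmProb d (criticalProbI d) (x i).natAbs ^ 2 ≤ tau d (criticalProbI d) 0 x ∧
          tau d (criticalProbI d) 0 x ≤ C * oneArmProb d (criticalProbI d) (x i).natAbs ^ 2 := by
  have hd1 : 1 ≤ d := by omega
  obtain ⟨c, hc, hlow⟩ := exists_mul_sq_oneArmProb_le_tau_cone_of_setToSetQuasiMultAspectAt hd h hϰ hs hsL
  set pc : unitInterval := criticalProbI d with hpcdef
  obtain ⟨c₀, hc₀, hQM⟩ := oneArmQuasiMultAt_of_setToSetQuasiMultAspectAt hd hs hsL.le hϰ h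
  have hD := oneArmDoublingAt_of_oneArmQuasiMultAt hd hc₀.le hQM
  set c₁ : ℝ := c₀ * ((85 : ℝ) ^ d)⁻¹ with hc₁
  have hc₁pos : 0 < c₁ := mul_pos hc₀ (inv_pos.2 (pow_pos (by norm_num) d))
  have hpc : 0 < (pc : ℝ) := by rw [hpcdef, coe_criticalProbI]; exact criticalProb_zd_pos d hd1
  have hπ2 : 0 < oneArmProb d pc 2 := (pow_pos hpc 2).trans_le (DKT20.pow_le_real_siteToBoundary hd1 pc 2)
  have hi2 : 0 < (oneArmProb d pc 2 ^ 2)⁻¹ := inv_pos.2 (pow_pos hπ2 2)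
  have hic : 0 ≤ ((c₁ ^ 2)⁻¹) ^ 2 := pow_nonneg (inv_nonneg.2 (sq_nonneg c₁)) 2
  refine ⟨c, ((c₁ ^ 2)⁻¹) ^ 2 + (oneArmProb d pc 2 ^ 2)⁻¹, hc, add_pos_of_nonneg_of_pos hic hi2, fun x i hxi hcone => ⟨hlow x i hxi hcone, ?_⟩⟩
  obtain ⟨n, hn⟩ : ∃ n : ℕ, n = (x i).natAbs := ⟨_, rfl⟩
  rw [← hn] at hxi ⊢
  have hτ1 : tau d pc 0 x ≤ 1 := measureReal_le_one
  have hπn0 : 0 ≤ oneArmProb d pc n := measureReal_nonneg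
  have hA0 : 0 ≤ ((c₁ ^ 2)⁻¹) ^ 2 * oneArmProb d pc n ^ 2 := mul_nonneg hic (sq_nonneg _)
  have hB0 : 0 ≤ (oneArmProb d pc 2 ^ 2)⁻¹ * oneArmProb d pc n ^ 2 := mul_nonneg hi2.le (sq_nonneg _)
  by_cases hn2 : n ≤ 2
  · have hmono : oneArmProb d pc 2 ≤ oneArmProb d pc n := DCT16.real_siteToBoundary_antitone pc hn2
    have hratio : 1 ≤ (oneArmProb d pc 2 ^ 2)⁻¹ * oneArmProb d pc n ^ 2 := by
      rw [inv_mul_eq_div, one_le_div (pow_pos hπ2 2)]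
      exact pow_le_pow_left₀ hπ2.le hmono 2
    calc tau d pc 0 x ≤ 1 := hτ1
      _ ≤ (oneArmProb d pc 2 ^ 2)⁻¹ * oneArmProb d pc n ^ 2 := hratio
      _ ≤ (((c₁ ^ 2)⁻¹) ^ 2 + (oneArmProb d pc 2 ^ 2)⁻¹) * oneArmProb d pc n ^ 2 := by rw [add_mul]; linarith
  · push Not at hn2
    obtain ⟨k, hk⟩ : ∃ k : ℕ, k = (n - 1) / 2 := ⟨_, rfl⟩
    have hk1 : 1 ≤ k := by omega
    have h2k : 2 * k < n := by omega
    have hn4k : n ≤ 4 * k := by omega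
    have hτ : tau d pc 0 x ≤ oneArmProb d pc k ^ 2 := tau_le_sq_oneArmProb_of_lt pc (i := i) (by rw [← hn]; exact h2k)
    have hd1' := hD k hk1
    have hd2' := hD (2 * k) (by omega)
    rw [show 2 * (2 * k) = 4 * k by ring] at hd2'
    have hmono : oneArmProb d pc (4 * k) ≤ oneArmProb d pc n := DCT16.real_siteToBoundary_antitone pc hn4k
    have hπk0 : 0 ≤ oneArmProb d pc k := measureReal_nonneg
    have hchain : c₁ ^ 2 * oneArmProb d pc k ≤ oneArmProb d pc n := by
      calc c₁ ^ 2 * oneArmProb d pc k = c₁ * (c₁ * oneArmProb d pc k) := by ring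
        _ ≤ c₁ * oneArmProb d pc (2 * k) := mul_le_mul_of_nonneg_left hd1' hc₁pos.le
        _ ≤ oneArmProb d pc (4 * k) := hd2'
        _ ≤ oneArmProb d pc n := hmono
    have hπk : oneArmProb d pc k ≤ (c₁ ^ 2)⁻¹ * oneArmProb d pc n := by
      rw [inv_mul_eq_div, le_div_iff₀ (pow_pos hc₁pos 2), mul_comm]; exact hchain
    calc tau d pc 0 x ≤ oneArmProb d pc k ^ 2 := hτ
      _ ≤ ((c₁ ^ 2)⁻¹ * oneArmProb d pc n) ^ 2 := pow_le_pow_left₀ hπk0 hπk 2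
      _ = ((c₁ ^ 2)⁻¹) ^ 2 * oneArmProb d pc n ^ 2 := by ring
      _ ≤ (((c₁ ^ 2)⁻¹) ^ 2 + (oneArmProb d pc 2 ^ 2)⁻¹) * oneArmProb d pc n ^ 2 := by rw [add_mul]; linarith

end Rsw3

end Summit.CriticalPhenomena.PercolationContinuityZ3.Theorems
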